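import Literature.MathematicalPhysics.QuantumManyBody.PeriodicFeynmanKacCell
import Mathlib.MeasureTheory.Function.L2Space
import Mathlib.Analysis.InnerProductSpace.Dual
import HarnessLib

/-!
# Periodic Feynman–Kac: the torus semigroup as bounded operators on `L²(cell)`

Topic `Literature/MathematicalPhysics/QuantumManyBody` (definition step of the proof of the named
fact `Literature.MathematicalPhysics.QuantumManyBody.BoseGas.PeriodicGroundStateFeynmanKac`,
`PeriodicHeatFlowSpectral.lean`); torus twin of `GroundStateFeynmanKacOperator.lean`. The
periodic Feynman–Kac functional `periodicFKSemigroup v L t` of `PeriodicHeatFlow.lean` acts on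
`[0, ∞]`-valued observables; the spectral theory (Perron–Frobenius for the compact self-adjoint
operator `e^{-tH_N^per}`, Chung–Zhao (1995) §3.2, Reed–Simon IV Thm XIII.44) needs it as a bounded
linear operator on the real Hilbert space `L²([0,L)^{3N}, dX)` = `L²` of the torus. This file
provides:

* `pfkReal v L t f X = E_X[e^{-∫₀ᵗ V^per(B_s)ds} f(B_t)]` — the functional of a REAL observable
  (Bochner integral of `weight × f(endpoint)`), i.e. `(e^{-tH} f)(X)` path-wise for signed periodic
  `f`; for `f ≥ 0` it is `(periodicFKSemigroup v L t (ofReal ∘ f) X).toReal`;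
* its basic analysis: `‖pfkReal f X‖ ≤ (e^{-tH}|f|)(X)`, measurability, periodicity, covariance,
  integrability of the integrand and linearity for periodic `f ∈ L²(cell)` (`t > 0`), insensitivity
  to null modifications (`t > 0`), the pointwise `L²(cell) → L^∞` bound
  (`enorm_pfkReal_le_L2cell`, from `PeriodicFeynmanKacCell.lean`) and the **`L²(cell)`
  contraction** `∫_cell (e^{-tH} f)² ≤ ∫_cell f²` for periodic `f` (Cauchy–Schwarz in the weighted
  path measure and the shift invariance of cell integrals of periodic functions; Chung–Zhao
  Thm 3.10 (27), `‖T_t‖_2 ≤ 1` for `q ≤ 0`);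
* `pfkL2 v L t : L²(cell) →L[ℝ] L²(cell)` — **the torus Feynman–Kac semigroup as a bounded
  operator** on `Lp ℝ 2 (volume.restrict (cellN N L))`: a class `g` is read through the PERIODIC
  EXTENSION `g ∘ cellProj L` of its representative, `(pfkL2 v L t g)(X) = pfkReal v L t (g ∘ cellProj L) X`
  a.e. on the cell (`pfkL2_coeFn`), of norm `≤ 1`; junk value `0` unless `v` is measurable,
  `t > 0` and `L > 0`;
* `pfkEval v L t X : L²(cell) →L[ℝ] ℝ` — the bounded evaluation functional
  `g ↦ (e^{-tH} g)(X)` (`t > 0`), whose Riesz vector is the torus kernel `u_t(X, ·) ∈ L²(cell)`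
  (Chung–Zhao Thm 3.10: `T_t` maps `L²` into `L^∞`).

## References

* K. L. Chung, Z. Zhao, *From Brownian Motion to Schrödinger's Equation* (1995), §3.2 (26)–(28)
  and Thm 3.10. [ChungZhao1995]
* M. Reed, B. Simon, *Methods of Modern Mathematical Physics IV* (1978), §XIII.12.

## Design

The Hilbert space is `Lp ℝ 2 (volume.restrict (cellN N L))` (a finite measure); a class is read
through the periodic extension `⇑g ∘ cellProj L` of its canonical representative, which is
periodic, agrees with `⇑g` on the cell, and changes only on a null set of `(ℝ³)^N` when `⇑g`
changes on a null set of the cell (`ae_comp_cellProj`), so for `t > 0` the operators are well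
defined on classes. No named fact is introduced.
-/

noncomputable section

namespace Literature.MathematicalPhysics.QuantumManyBody.BoseGas

open MeasureTheory ProbabilityTheory Filter Set
open scoped ENNReal NNReal Topology InnerProductSpace
open Literature.Probability.Process

variable {N : ℕ}

/-! ### The periodic Feynman–Kac functional of a real observable -/

/-- **The periodic Feynman–Kac functional of a real observable**:
`pfkReal v L t f X = E_X[e^{-∫₀ᵗ ∑_{i<j} v^per(Bⁱ_s - Bʲ_s) ds} f(B_t)]`, the torus Schrödinger
semigroup `(e^{-tH_N^per} f)(X)` evaluated path-wise on a signed observable `f : (ℝ³)^N → ℝ`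
(Bochner integral of `weight × f(endpoint)` against `wienerPaths N`).
[cite: ChungZhao1995, §3.2 (26)] -/
def pfkReal (v : ℝ → ℝ≥0∞) (L t : ℝ) (f : Config N → ℝ) (X : Config N) : ℝ :=
  ∫ ω, (periodicFKWeight v L t X ω).toReal * f (worldLine X ω t.toNNReal) ∂wienerPaths N

/-- The real functional is the real part of the complex flow of the real data. [folklore] -/
theorem pfkReal_eq_re_periodicHeatFlow (v : ℝ → ℝ≥0∞) (L t : ℝ) (f : Config N → ℝ)
    (X : Config N) : pfkReal v L t f X = (periodicHeatFlow v N L t (fun Y => (f Y : ℂ)) X).re := by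
  rw [periodicHeatFlow_ofReal, Complex.ofReal_re, pfkReal]

/-- The `ℝ≥0∞`-norm of the real integrand is the `[0, ∞]`-weighted norm of the observable.
[folklore] -/
theorem enorm_pfkIntegrand (v : ℝ → ℝ≥0∞) (L t : ℝ) (f : Config N → ℝ) (X : Config N)
    (ω : PathSpace N) :
    ‖(periodicFKWeight v L t X ω).toReal * f (worldLine X ω t.toNNReal)‖ₑ =
      periodicFKWeight v L t X ω * ‖f (worldLine X ω t.toNNReal)‖ₑ := by
  rw [enorm_mul, Real.enorm_of_nonneg ENNReal.toReal_nonneg,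
    ENNReal.ofReal_toReal (periodicFKWeight_ne_top v L t X ω)]

/-- **`|e^{-tH} f| ≤ e^{-tH} |f|` pointwise**:
`‖pfkReal v L t f X‖ₑ ≤ periodicFKSemigroup v L t ‖f‖ₑ X`. [folklore] -/
theorem enorm_pfkReal_le (v : ℝ → ℝ≥0∞) (L t : ℝ) (f : Config N → ℝ) (X : Config N) :
    ‖pfkReal v L t f X‖ₑ ≤ periodicFKSemigroup v L t (fun Y => ‖f Y‖ₑ) X := by
  refine (enorm_integral_le_lintegral_enorm _).trans (le_of_eq ?_)
  simp only [enorm_pfkIntegrand]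
  rfl

/-- The real integrand is measurable jointly in the starting point and the sample. [folklore] -/
theorem measurable_pfkIntegrand_uncurry {v : ℝ → ℝ≥0∞} (hv : Measurable v) (L t : ℝ)
    {f : Config N → ℝ} (hf : Measurable f) :
    Measurable fun p : Config N × PathSpace N =>
      (periodicFKWeight v L t p.1 p.2).toReal * f (worldLine p.1 p.2 t.toNNReal) :=
  (measurable_periodicFKWeight_uncurry hv L t).ennreal_toReal.mul
    (hf.comp (measurable_worldLine_uncurry' t.toNNReal))

/-- The real integrand is measurable in the sample. [folklore] -/
theorem measurable_pfkIntegrand {v : ℝ → ℝ≥0∞} (hv : Measurable v) (L t : ℝ)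
    {f : Config N → ℝ} (hf : Measurable f) (X : Config N) :
    Measurable fun ω : PathSpace N =>
      (periodicFKWeight v L t X ω).toReal * f (worldLine X ω t.toNNReal) :=
  (measurable_periodicFKWeight hv L t X).ennreal_toReal.mul (hf.comp (measurable_worldLine X _))

/-- **Measurability of `X ↦ (e^{-tH} f)(X)`** for measurable `v` and `f`. [folklore] -/
@[fun_prop]
theorem measurable_pfkReal {v : ℝ → ℝ≥0∞} (hv : Measurable v) (L t : ℝ) {f : Config N → ℝ}
    (hf : Measurable f) : Measurable (pfkReal v L t f) :=
  ((measurable_pfkIntegrand_uncurry hv L t hf).stronglyMeasurable.integral_prod_right'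
    (ν := wienerPaths N)).measurable

/-- For a nonnegative observable the real functional is the `[0, ∞]`-valued one, read in `ℝ`:
`pfkReal v L t f X = (periodicFKSemigroup v L t (ofReal ∘ f) X).toReal`. [folklore] -/
theorem pfkReal_eq_toReal_periodicFKSemigroup {v : ℝ → ℝ≥0∞} (hv : Measurable v) (L t : ℝ)
    {f : Config N → ℝ} (hf : Measurable f) (hf0 : ∀ Y, 0 ≤ f Y) (X : Config N) :
    pfkReal v L t f X = (periodicFKSemigroup v L t (fun Y => ENNReal.ofReal (f Y)) X).toReal := by
  rw [pfkReal, integral_eq_lintegral_of_nonneg_ae (Eventually.of_forall fun ω =>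
      mul_nonneg ENNReal.toReal_nonneg (hf0 _))
    (measurable_pfkIntegrand hv L t hf X).aestronglyMeasurable]
  congr 1
  refine lintegral_congr fun ω => ?_
  rw [ENNReal.ofReal_mul ENNReal.toReal_nonneg,
    ENNReal.ofReal_toReal (periodicFKWeight_ne_top v L t X ω)]

/-- **`f ≥ 0 ⇒ e^{-tH} f ≥ 0`** pointwise. [folklore] -/
theorem pfkReal_nonneg (v : ℝ → ℝ≥0∞) (L t : ℝ) {f : Config N → ℝ} (hf : ∀ Y, 0 ≤ f Y)
    (X : Config N) : 0 ≤ pfkReal v L t f X :=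
  integral_nonneg fun _ => mul_nonneg ENNReal.toReal_nonneg (hf _)

/-- **`|e^{-tH} f| ≤ e^{-tH} |f|`** pointwise (real form). [folklore] -/
theorem abs_pfkReal_le (v : ℝ → ℝ≥0∞) (L t : ℝ) (f : Config N → ℝ) (X : Config N) :
    |pfkReal v L t f X| ≤ pfkReal v L t (fun Y => |f Y|) X := by
  refine (abs_integral_le_integral_abs).trans (le_of_eq ?_)
  refine integral_congr_ae (Eventually.of_forall fun ω => ?_)
  simp only [abs_mul, abs_of_nonneg ENNReal.toReal_nonneg]

/-- At nonpositive times the functional is the identity. [folklore] -/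
theorem pfkReal_of_nonpos (v : ℝ → ℝ≥0∞) (L : ℝ) {t : ℝ} (ht : t ≤ 0) (f : Config N → ℝ)
    (X : Config N) : pfkReal v L t f X = f X := by
  simp [pfkReal, periodicFKWeight_of_nonpos v L ht, Real.toNNReal_of_nonpos ht]

/-! ### Covariance and periodicity -/

/-- **Covariance under a lattice translation of one particle**:
`(e^{-tH} f)(X + L e_{i,k}) = (e^{-tH} f(· + L e_{i,k}))(X)`. [folklore] -/
theorem pfkReal_add_single (v : ℝ → ℝ≥0∞) (L t : ℝ) (f : Config N → ℝ) (X : Config N)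
    (i : Fin N) (k : Fin 3) :
    pfkReal v L t f (X + Pi.single i (EuclideanSpace.single k L)) =
      pfkReal v L t (fun Y => f (Y + Pi.single i (EuclideanSpace.single k L))) X := by
  simp only [pfkReal, periodicFKWeight_add_single, worldLine_add_right]

/-- **Periodic observables have periodic images.** [folklore] -/
theorem pfkReal_add_single_of_periodic (v : ℝ → ℝ≥0∞) (L t : ℝ) {f : Config N → ℝ}
    (hper : ∀ (Y : Config N) (i : Fin N) (k : Fin 3),
      f (Y + Pi.single i (EuclideanSpace.single k L)) = f Y)
    (X : Config N) (i : Fin N) (k : Fin 3) :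
    pfkReal v L t f (X + Pi.single i (EuclideanSpace.single k L)) = pfkReal v L t f X := by
  rw [pfkReal_add_single]
  simp only [hper]

/-- **Bose symmetry**: relabelling the particles commutes with the functional,
`(e^{-tH} f)(X ∘ σ) = (e^{-tH} (f ∘ (· ∘ σ)))(X)`. [folklore] -/
theorem pfkReal_comp_perm (v : ℝ → ℝ≥0∞) (L t : ℝ) (f : Config N → ℝ)
    (σ : Equiv.Perm (Fin N)) (X : Config N) :
    pfkReal v L t f (X ∘ σ) = pfkReal v L t (fun Y => f (Y ∘ σ)) X := by
  have h := periodicHeatFlow_comp_perm v L t (fun Y => (f Y : ℂ)) σ X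
  rw [pfkReal_eq_re_periodicHeatFlow, pfkReal_eq_re_periodicHeatFlow, h]

/-! ### Integrability of the integrand and linearity, for periodic `L²(cell)` observables -/

/-- The `[0, ∞]`-weighted expectation of `|f|(B_t)` is finite for periodic `f` square integrable
on the cell (`t > 0`, `L > 0`; `L²(cell) → L^∞` bound). [folklore] -/
theorem periodicFKSemigroup_enorm_lt_top (v : ℝ → ℝ≥0∞) {L : ℝ} (hL : 0 < L) {t : ℝ}
    (ht : 0 < t) {f : Config N → ℝ} (hf : Measurable f)
    (hper : ∀ (Y : Config N) (i : Fin N) (k : Fin 3),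
      f (Y + Pi.single i (EuclideanSpace.single k L)) = f Y)
    (hf2 : ∫⁻ Y in cellN N L, ‖f Y‖ₑ ^ (2 : ℝ) ≠ ⊤) (X : Config N) :
    periodicFKSemigroup v L t (fun Y => ‖f Y‖ₑ) X < ⊤ :=
  periodicFKSemigroup_lt_top_of_cell v hL ht hf.enorm (fun Y i k => by rw [hper]) hf2 X

/-- **Integrability of the periodic Feynman–Kac integrand** `ω ↦ w_t(X, ω) f(B_t)` for periodic
`f` measurable and square integrable on the cell (`t > 0`, `L > 0`). [folklore] -/
theorem integrable_pfkIntegrand {v : ℝ → ℝ≥0∞} (hv : Measurable v) {L : ℝ} (hL : 0 < L) {t : ℝ}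
    (ht : 0 < t) {f : Config N → ℝ} (hf : Measurable f)
    (hper : ∀ (Y : Config N) (i : Fin N) (k : Fin 3),
      f (Y + Pi.single i (EuclideanSpace.single k L)) = f Y)
    (hf2 : ∫⁻ Y in cellN N L, ‖f Y‖ₑ ^ (2 : ℝ) ≠ ⊤) (X : Config N) :
    Integrable (fun ω : PathSpace N =>
      (periodicFKWeight v L t X ω).toReal * f (worldLine X ω t.toNNReal)) (wienerPaths N) := by
  refine ⟨(measurable_pfkIntegrand hv L t hf X).aestronglyMeasurable, ?_⟩
  unfold HasFiniteIntegral
  simp only [enorm_pfkIntegrand]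
  exact periodicFKSemigroup_enorm_lt_top v hL ht hf hper hf2 X

/-- **Additivity** of the real functional on periodic `L²(cell)` observables (`t > 0`).
[folklore] -/
theorem pfkReal_add {v : ℝ → ℝ≥0∞} (hv : Measurable v) {L : ℝ} (hL : 0 < L) {t : ℝ}
    (ht : 0 < t) {f g : Config N → ℝ} (hf : Measurable f) (hg : Measurable g)
    (hfper : ∀ (Y : Config N) (i : Fin N) (k : Fin 3),
      f (Y + Pi.single i (EuclideanSpace.single k L)) = f Y)
    (hgper : ∀ (Y : Config N) (i : Fin N) (k : Fin 3),
      g (Y + Pi.single i (EuclideanSpace.single k L)) = g Y)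
    (hf2 : ∫⁻ Y in cellN N L, ‖f Y‖ₑ ^ (2 : ℝ) ≠ ⊤) (hg2 : ∫⁻ Y in cellN N L, ‖g Y‖ₑ ^ (2 : ℝ) ≠ ⊤)
    (X : Config N) : pfkReal v L t (f + g) X = pfkReal v L t f X + pfkReal v L t g X := by
  simp only [pfkReal, Pi.add_apply, mul_add]
  exact integral_add (integrable_pfkIntegrand hv hL ht hf hfper hf2 X)
    (integrable_pfkIntegrand hv hL ht hg hgper hg2 X)

/-- **Homogeneity** of the real functional. [folklore] -/
theorem pfkReal_smul (v : ℝ → ℝ≥0∞) (L t : ℝ) (c : ℝ) (f : Config N → ℝ) (X : Config N) :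
    pfkReal v L t (c • f) X = c * pfkReal v L t f X := by
  simp only [pfkReal, Pi.smul_apply, smul_eq_mul, ← integral_const_mul]
  refine integral_congr_ae (Eventually.of_forall fun ω => ?_)
  ring

/-- Homogeneity, function form. [folklore] -/
theorem pfkReal_const_mul (v : ℝ → ℝ≥0∞) (L t : ℝ) (c : ℝ) (f : Config N → ℝ) (X : Config N) :
    pfkReal v L t (fun Y => c * f Y) X = c * pfkReal v L t f X :=
  pfkReal_smul v L t c f X

/-- The functional of `-f`. [folklore] -/
theorem pfkReal_neg (v : ℝ → ℝ≥0∞) (L t : ℝ) (f : Config N → ℝ) (X : Config N) :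
    pfkReal v L t (-f) X = -pfkReal v L t f X := by
  have h := pfkReal_smul v L t (-1) f X
  simpa using h

/-- **Null modifications are invisible** (`t > 0`): if `f = g` a.e. on `(ℝ³)^N` then
`pfkReal v L t f = pfkReal v L t g` everywhere. [folklore] -/
theorem pfkReal_congr_ae (v : ℝ → ℝ≥0∞) (L : ℝ) {t : ℝ} (ht : 0 < t) {f g : Config N → ℝ}
    (h : f =ᵐ[volume] g) (X : Config N) : pfkReal v L t f X = pfkReal v L t g X := by
  refine integral_congr_ae ?_
  filter_upwards [comp_worldLine_ae_eq X (t := t.toNNReal) (by simpa using ht) h] with ω hω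
  rw [hω]

/-- **Null modifications on the cell are invisible through the periodic extension** (`t > 0`,
`L > 0`): if `f = g` a.e. on the cell then `pfkReal v L t (f ∘ cellProj L) = pfkReal v L t (g ∘ cellProj L)`
everywhere. [folklore] -/
theorem pfkReal_comp_cellProj_congr_ae (v : ℝ → ℝ≥0∞) {L : ℝ} (hL : 0 < L) {t : ℝ} (ht : 0 < t)
    {f g : Config N → ℝ} (h : f =ᵐ[volume.restrict (cellN N L)] g) (X : Config N) :
    pfkReal v L t (f ∘ cellProj L) X = pfkReal v L t (g ∘ cellProj L) X :=
  pfkReal_congr_ae v L ht (ae_comp_cellProj hL h) X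

/-! ### The pointwise `L²(cell) → L^∞` bound and the `L²(cell)` contraction -/

/-- **Pointwise `L²(cell) → L^∞` bound**: for `t > 0`, `L > 0` and periodic measurable `f`,
`‖(e^{-tH} f)(X)‖ ≤ pHeatConst N L t · |cell|^{1/2} · ‖f‖_{L²(cell)}`, uniformly in `X`.
Chung–Zhao (1995), Thm 3.10 (`T_t : L² → L^∞`). [cite: ChungZhao1995, Thm 3.10] -/
theorem enorm_pfkReal_le_L2cell (v : ℝ → ℝ≥0∞) {L : ℝ} (hL : 0 < L) {t : ℝ} (ht : 0 < t)
    {f : Config N → ℝ} (hf : Measurable f)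
    (hper : ∀ (Y : Config N) (i : Fin N) (k : Fin 3),
      f (Y + Pi.single i (EuclideanSpace.single k L)) = f Y) (X : Config N) :
    ‖pfkReal v L t f X‖ₑ ≤
      pHeatConst N L t.toNNReal * volume (cellN N L) ^ (1 / 2 : ℝ) *
        (∫⁻ Y in cellN N L, ‖f Y‖ₑ ^ (2 : ℝ)) ^ (1 / 2 : ℝ) :=
  (enorm_pfkReal_le v L t f X).trans
    (periodicFKSemigroup_le_L2cell v hL ht hf.enorm (fun Y i k => by rw [hper]) X)

/-- **Cauchy–Schwarz in the weighted path measure**: `(E_X[w F(B_t)])² ≤ E_X[w F(B_t)²]`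
(`E_X[w] ≤ 1`), for measurable `F ≥ 0`. [folklore] -/
theorem lintegral_periodicFKWeight_mul_sq_le {v : ℝ → ℝ≥0∞} (hv : Measurable v) (L t : ℝ)
    {F : Config N → ℝ≥0∞} (hF : Measurable F) (X : Config N) :
    (∫⁻ ω, periodicFKWeight v L t X ω * F (worldLine X ω t.toNNReal) ∂wienerPaths N) ^ (2 : ℝ) ≤
      ∫⁻ ω, periodicFKWeight v L t X ω * F (worldLine X ω t.toNNReal) ^ (2 : ℝ) ∂wienerPaths N := by
  have hFm : AEMeasurable (fun ω => F (worldLine X ω t.toNNReal)) (periodicFKPathMeasure v L t X) :=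
    (hF.comp (measurable_worldLine X _)).aemeasurable
  have h1 := ENNReal.lintegral_mul_le_Lp_mul_Lq (periodicFKPathMeasure v L t X)
    Real.HolderConjugate.two_two (f := fun _ => 1)
    (g := fun ω => F (worldLine X ω t.toNNReal)) aemeasurable_const hFm
  rw [← lintegral_periodicFKPathMeasure hv, ← lintegral_periodicFKPathMeasure hv]
  have hZ : (∫⁻ _ω, (1 : ℝ≥0∞) ^ (2 : ℝ) ∂periodicFKPathMeasure v L t X) ^ (1 / (2 : ℝ)) ≤ 1 := by
    simp only [ENNReal.one_rpow, lintegral_const, one_mul]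
    refine ENNReal.rpow_le_one ?_ (by norm_num)
    rw [periodicFKPathMeasure_univ]
    exact periodicFKSemigroup_one_le_one v L t X
  simp only [Pi.mul_apply, one_mul] at h1
  have h2 : ∫⁻ ω, F (worldLine X ω t.toNNReal) ∂periodicFKPathMeasure v L t X ≤
      (∫⁻ ω, F (worldLine X ω t.toNNReal) ^ (2 : ℝ) ∂periodicFKPathMeasure v L t X) ^ (1 / (2 : ℝ)) :=
    h1.trans (mul_le_of_le_one_left bot_le hZ)
  calc (∫⁻ ω, F (worldLine X ω t.toNNReal) ∂periodicFKPathMeasure v L t X) ^ (2 : ℝ)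
      ≤ ((∫⁻ ω, F (worldLine X ω t.toNNReal) ^ (2 : ℝ) ∂periodicFKPathMeasure v L t X) ^
          (1 / (2 : ℝ))) ^ (2 : ℝ) := ENNReal.rpow_le_rpow h2 (by norm_num)
    _ = _ := by rw [← ENNReal.rpow_mul]; norm_num

/-- **Pointwise square bound**: `‖(e^{-tH} f)(X)‖² ≤ E_X[w_t f(B_t)²]`. [folklore] -/
theorem enorm_pfkReal_sq_le {v : ℝ → ℝ≥0∞} (hv : Measurable v) (L t : ℝ) {f : Config N → ℝ}
    (hf : Measurable f) (X : Config N) :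
    ‖pfkReal v L t f X‖ₑ ^ (2 : ℝ) ≤
      ∫⁻ ω, periodicFKWeight v L t X ω * ‖f (worldLine X ω t.toNNReal)‖ₑ ^ (2 : ℝ) ∂wienerPaths N :=
  (ENNReal.rpow_le_rpow (enorm_pfkReal_le v L t f X) (by norm_num)).trans
    (lintegral_periodicFKWeight_mul_sq_le hv L t hf.enorm X)

/-- **The `L²(cell)` contraction** `∫_cell ‖e^{-tH} f‖² dX ≤ ∫_cell ‖f‖² dX` for periodic
measurable `f` and `L > 0`: Cauchy–Schwarz in the weighted path measure, Tonelli, the weight bound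
`w ≤ 1` and the shift invariance of cell integrals of periodic functions under the Gaussian
displacement `B_t = X + √2 b_t`. Chung–Zhao (1995), Thm 3.10 (27) (`‖T_t‖_2 ≤ 1` for `q ≤ 0`).
[cite: ChungZhao1995, Thm 3.10] -/
theorem setLIntegral_cellN_enorm_pfkReal_sq_le {v : ℝ → ℝ≥0∞} (hv : Measurable v) {L : ℝ}
    (hL : 0 < L) (t : ℝ) {f : Config N → ℝ} (hf : Measurable f)
    (hper : ∀ (Y : Config N) (i : Fin N) (k : Fin 3),
      f (Y + Pi.single i (EuclideanSpace.single k L)) = f Y) :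
    ∫⁻ X in cellN N L, ‖pfkReal v L t f X‖ₑ ^ (2 : ℝ) ≤ ∫⁻ Y in cellN N L, ‖f Y‖ₑ ^ (2 : ℝ) := by
  have hm : Measurable (Function.uncurry fun (X : Config N) (ω : PathSpace N) =>
      periodicFKWeight v L t X ω * ‖f (worldLine X ω t.toNNReal)‖ₑ ^ (2 : ℝ)) :=
    (measurable_periodicFKWeight_uncurry hv L t).mul
      ((hf.comp (measurable_worldLine_uncurry' t.toNNReal)).enorm.pow_const _)
  have hper2 : ∀ (Y : Config N) (i : Fin N) (k : Fin 3),
      ‖f (Y + Pi.single i (EuclideanSpace.single k L))‖ₑ ^ (2 : ℝ) = ‖f Y‖ₑ ^ (2 : ℝ) := by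
    intro Y i k; rw [hper]
  calc ∫⁻ X in cellN N L, ‖pfkReal v L t f X‖ₑ ^ (2 : ℝ)
      ≤ ∫⁻ X in cellN N L, ∫⁻ ω, periodicFKWeight v L t X ω * ‖f (worldLine X ω t.toNNReal)‖ₑ ^ (2 : ℝ)
          ∂wienerPaths N := lintegral_mono fun X => enorm_pfkReal_sq_le hv L t hf X
    _ = ∫⁻ ω, ∫⁻ X in cellN N L, periodicFKWeight v L t X ω * ‖f (worldLine X ω t.toNNReal)‖ₑ ^ (2 : ℝ)
          ∂volume ∂wienerPaths N := lintegral_lintegral_swap hm.aemeasurable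
    _ ≤ ∫⁻ ω, ∫⁻ X in cellN N L, ‖f (worldLine X ω t.toNNReal)‖ₑ ^ (2 : ℝ) ∂volume ∂wienerPaths N := by
        refine lintegral_mono fun ω => lintegral_mono fun X => ?_
        calc periodicFKWeight v L t X ω * ‖f (worldLine X ω t.toNNReal)‖ₑ ^ (2 : ℝ)
            ≤ 1 * ‖f (worldLine X ω t.toNNReal)‖ₑ ^ (2 : ℝ) :=
              mul_le_mul' (periodicFKWeight_le_one v L t X ω) le_rfl
          _ = _ := one_mul _
    _ = ∫⁻ _ω, ∫⁻ Y in cellN N L, ‖f Y‖ₑ ^ (2 : ℝ) ∂volume ∂wienerPaths N := by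
        refine lintegral_congr fun ω => ?_
        simp only [worldLine_eq_add _ ω]
        exact lintegral_cellN_comp_add hL (G := fun Y => ‖f Y‖ₑ ^ (2 : ℝ)) hper2 _
    _ = ∫⁻ Y in cellN N L, ‖f Y‖ₑ ^ (2 : ℝ) := by
        rw [lintegral_const, measure_univ, mul_one]

/-! ### `L²(cell)` classes and their periodic extensions -/

/-- The squared `L²(cell)` mass as the square of the `eLpNorm`. [folklore] -/
theorem eLpNorm_two_eq_cellN (L : ℝ) (f : Config N → ℝ) :
    eLpNorm f 2 (volume.restrict (cellN N L)) =
      (∫⁻ Y in cellN N L, ‖f Y‖ₑ ^ (2 : ℝ)) ^ (1 / 2 : ℝ) := by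
  rw [eLpNorm_eq_lintegral_rpow_enorm_toReal two_ne_zero ENNReal.ofNat_ne_top]
  norm_num

/-- An `L²(cell)` class has finite squared mass on the cell. [folklore] -/
theorem setLIntegral_cellN_enorm_sq_ne_top {L : ℝ} (g : Lp ℝ 2 (volume.restrict (cellN N L))) :
    ∫⁻ Y in cellN N L, ‖g Y‖ₑ ^ (2 : ℝ) ≠ ⊤ := by
  have h := Lp.eLpNorm_lt_top g
  rw [eLpNorm_two_eq_cellN] at h
  intro htop
  rw [htop, ENNReal.top_rpow_of_pos (by norm_num)] at h
  exact lt_irrefl _ h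

/-- The canonical representative of an `L²(cell)` class is measurable. [folklore] -/
theorem measurable_coeFn_Lp_cellN {L : ℝ} (g : Lp ℝ 2 (volume.restrict (cellN N L))) :
    Measurable (g : Config N → ℝ) :=
  (Lp.stronglyMeasurable g).measurable

/-- The periodic extension agrees with the function on the cell, hence has the same cell
integrals. [folklore] -/
theorem setLIntegral_cellN_comp_cellProj {L : ℝ} (hL : 0 < L) (F : Config N → ℝ≥0∞) :
    ∫⁻ Y in cellN N L, (F ∘ cellProj L) Y = ∫⁻ Y in cellN N L, F Y :=
  setLIntegral_congr_fun (measurableSet_cellN N L) fun _ hY => comp_cellProj_apply_of_mem hL F hY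

/-- The periodic extension agrees with the function a.e. on the cell. [folklore] -/
theorem comp_cellProj_ae_eq_restrict {β : Type*} {L : ℝ} (hL : 0 < L) (f : Config N → β) :
    f ∘ cellProj L =ᵐ[volume.restrict (cellN N L)] f :=
  (ae_restrict_mem (measurableSet_cellN N L)).mono fun _ hY => comp_cellProj_apply_of_mem hL f hY

/-- The squared cell mass of the periodic extension is that of the function. [folklore] -/
theorem setLIntegral_cellN_enorm_comp_cellProj_sq {L : ℝ} (hL : 0 < L) (f : Config N → ℝ) :
    ∫⁻ Y in cellN N L, ‖(f ∘ cellProj L) Y‖ₑ ^ (2 : ℝ) = ∫⁻ Y in cellN N L, ‖f Y‖ₑ ^ (2 : ℝ) :=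
  setLIntegral_cellN_comp_cellProj hL (fun Y => ‖f Y‖ₑ ^ (2 : ℝ))

/-- **`e^{-tH}` maps `L²(cell)` to `L²(cell)`**: for `L > 0` and an `L²(cell)` class `g`,
`pfkReal v L t (g ∘ cellProj L) ∈ L²(cell)`. [folklore] -/
theorem memLp_pfkReal {v : ℝ → ℝ≥0∞} (hv : Measurable v) {L : ℝ} (hL : 0 < L) (t : ℝ)
    (g : Lp ℝ 2 (volume.restrict (cellN N L))) :
    MemLp (pfkReal v L t ((g : Config N → ℝ) ∘ cellProj L)) 2 (volume.restrict (cellN N L)) := by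
  refine ⟨(measurable_pfkReal hv L t ((measurable_coeFn_Lp_cellN g).comp (measurable_cellProj L))).aestronglyMeasurable,
    ?_⟩
  rw [eLpNorm_two_eq_cellN]
  refine ENNReal.rpow_lt_top_of_nonneg (by norm_num) (ne_of_lt ?_)
  refine (setLIntegral_cellN_enorm_pfkReal_sq_le hv hL t ((measurable_coeFn_Lp_cellN g).comp (measurable_cellProj L))
    (comp_cellProj_periodic hL.ne' _)).trans_lt ?_
  rw [setLIntegral_cellN_enorm_comp_cellProj_sq hL]
  exact lt_top_iff_ne_top.2 (setLIntegral_cellN_enorm_sq_ne_top g)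

/-- The `eLpNorm` bound `‖e^{-tH} g‖_{L²(cell)} ≤ ‖g‖_{L²(cell)}`. [folklore] -/
theorem eLpNorm_pfkReal_le {v : ℝ → ℝ≥0∞} (hv : Measurable v) {L : ℝ} (hL : 0 < L) (t : ℝ)
    (g : Lp ℝ 2 (volume.restrict (cellN N L))) :
    eLpNorm (pfkReal v L t ((g : Config N → ℝ) ∘ cellProj L)) 2 (volume.restrict (cellN N L)) ≤
      eLpNorm (g : Config N → ℝ) 2 (volume.restrict (cellN N L)) := by
  rw [eLpNorm_two_eq_cellN, eLpNorm_two_eq_cellN, ← setLIntegral_cellN_enorm_comp_cellProj_sq hL g]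
  exact ENNReal.rpow_le_rpow (setLIntegral_cellN_enorm_pfkReal_sq_le hv hL t
    ((measurable_coeFn_Lp_cellN g).comp (measurable_cellProj L)) (comp_cellProj_periodic hL.ne' _)) (by norm_num)

/-- The squared cell mass of the periodic extension of a class is finite. [folklore] -/
theorem setLIntegral_cellN_enorm_comp_cellProj_sq_ne_top {L : ℝ} (hL : 0 < L)
    (g : Lp ℝ 2 (volume.restrict (cellN N L))) :
    ∫⁻ Y in cellN N L, ‖((g : Config N → ℝ) ∘ cellProj L) Y‖ₑ ^ (2 : ℝ) ≠ ⊤ := by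
  rw [setLIntegral_cellN_enorm_comp_cellProj_sq hL]
  exact setLIntegral_cellN_enorm_sq_ne_top g

/-- Additivity of `pfkReal` on `L²(cell)` classes through the periodic extension (`t > 0`).
[folklore] -/
theorem pfkReal_coeFn_add {v : ℝ → ℝ≥0∞} (hv : Measurable v) {L : ℝ} (hL : 0 < L) {t : ℝ}
    (ht : 0 < t) (g g' : Lp ℝ 2 (volume.restrict (cellN N L))) :
    pfkReal v L t (⇑(g + g') ∘ cellProj L) =
      pfkReal v L t (⇑g ∘ cellProj L) + pfkReal v L t (⇑g' ∘ cellProj L) := by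
  funext X
  rw [pfkReal_comp_cellProj_congr_ae v hL ht (Lp.coeFn_add g g') X, Pi.add_apply]
  exact pfkReal_add hv hL ht ((measurable_coeFn_Lp_cellN g).comp (measurable_cellProj L))
    ((measurable_coeFn_Lp_cellN g').comp (measurable_cellProj L)) (comp_cellProj_periodic hL.ne' _)
    (comp_cellProj_periodic hL.ne' _) (setLIntegral_cellN_enorm_comp_cellProj_sq_ne_top hL g)
    (setLIntegral_cellN_enorm_comp_cellProj_sq_ne_top hL g') X

/-- Homogeneity of `pfkReal` on `L²(cell)` classes through the periodic extension (`t > 0`).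
[folklore] -/
theorem pfkReal_coeFn_smul {v : ℝ → ℝ≥0∞} {L : ℝ} (hL : 0 < L) {t : ℝ} (ht : 0 < t) (c : ℝ)
    (g : Lp ℝ 2 (volume.restrict (cellN N L))) :
    pfkReal v L t (⇑(c • g) ∘ cellProj L) = c • pfkReal v L t (⇑g ∘ cellProj L) := by
  funext X
  rw [pfkReal_comp_cellProj_congr_ae v hL ht (Lp.coeFn_smul c g) X, Pi.smul_apply, smul_eq_mul]
  exact pfkReal_smul v L t c _ X

/-! ### The operators -/

/-- **The torus Feynman–Kac semigroup as a bounded operator on `L²([0,L)^{3N})`**: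
`pfkL2 v L t : L²(cell) →L[ℝ] L²(cell)`, `g ↦ [X ↦ (e^{-tH_N^per} g)(X)] = pfkReal v L t (g ∘ cellProj L)`
(as an `L²(cell)` class; the class is read through the periodic extension of its representative),
the Schrödinger semigroup of `H_N^per = -∑Δᵢ + ∑_{i<j} v^per(xᵢ-xⱼ)` on the torus realised
path-wise (Chung–Zhao's `T_t` (26) on `L²(S, m)`, `S` the torus with its Haar measure).
**Junk value** `0` unless `v` is measurable, `t > 0` and `L > 0`. [cite: ChungZhao1995, §3.2 (26) and Thm 3.10] -/
def pfkL2 (v : ℝ → ℝ≥0∞) (L t : ℝ) :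
    Lp ℝ 2 (volume.restrict (cellN N L)) →L[ℝ] Lp ℝ 2 (volume.restrict (cellN N L)) :=
  open Classical in
  if h : Measurable v ∧ 0 < t ∧ 0 < L then
    LinearMap.mkContinuous
      { toFun := fun g => (memLp_pfkReal h.1 h.2.2 t g).toLp (pfkReal v L t (⇑g ∘ cellProj L))
        map_add' := fun g g' => by
          rw [← MemLp.toLp_add (memLp_pfkReal h.1 h.2.2 t g) (memLp_pfkReal h.1 h.2.2 t g')]
          exact MemLp.toLp_congr _ _ (Eventually.of_forall fun X => by
            rw [pfkReal_coeFn_add h.1 h.2.2 h.2.1 g g'])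
        map_smul' := fun c g => by
          rw [RingHom.id_apply, ← MemLp.toLp_const_smul c (memLp_pfkReal h.1 h.2.2 t g)]
          exact MemLp.toLp_congr _ _ (Eventually.of_forall fun X => by
            rw [pfkReal_coeFn_smul h.2.2 h.2.1 c g]) }
      1 (fun g => by
        simp only [LinearMap.coe_mk, AddHom.coe_mk, one_mul, Lp.norm_toLp]
        rw [Lp.norm_def]
        exact ENNReal.toReal_mono (Lp.eLpNorm_ne_top g) (eLpNorm_pfkReal_le h.1 h.2.2 t g))
  else 0

/-- **`pfkL2` acts by `pfkReal` on the periodic extension**: for measurable `v`, `t > 0`, `L > 0`,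
`(pfkL2 v L t g)(X) = pfkReal v L t (g ∘ cellProj L) X` for a.e. `X` in the cell. [folklore] -/
theorem pfkL2_coeFn {v : ℝ → ℝ≥0∞} (hv : Measurable v) {L : ℝ} (hL : 0 < L) {t : ℝ} (ht : 0 < t)
    (g : Lp ℝ 2 (volume.restrict (cellN N L))) :
    (pfkL2 v L t g : Config N → ℝ) =ᵐ[volume.restrict (cellN N L)]
      pfkReal v L t (⇑g ∘ cellProj L) := by
  have h : Measurable v ∧ 0 < t ∧ 0 < L := ⟨hv, ht, hL⟩
  simp only [pfkL2, dif_pos h, LinearMap.mkContinuous_apply, LinearMap.coe_mk, AddHom.coe_mk]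
  exact MemLp.coeFn_toLp _

/-- `pfkL2 v L t g` is the `L²(cell)` class of `pfkReal v L t (g ∘ cellProj L)`. [folklore] -/
theorem pfkL2_apply {v : ℝ → ℝ≥0∞} (hv : Measurable v) {L : ℝ} (hL : 0 < L) {t : ℝ} (ht : 0 < t)
    (g : Lp ℝ 2 (volume.restrict (cellN N L))) :
    pfkL2 v L t g = (memLp_pfkReal hv hL t g).toLp (pfkReal v L t (⇑g ∘ cellProj L)) := by
  have h : Measurable v ∧ 0 < t ∧ 0 < L := ⟨hv, ht, hL⟩
  simp only [pfkL2, dif_pos h, LinearMap.mkContinuous_apply, LinearMap.coe_mk, AddHom.coe_mk]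

/-- **`‖e^{-tH}‖_{L²(cell) → L²(cell)} ≤ 1`** (contraction). Chung–Zhao (1995), Thm 3.10 (27).
[cite: ChungZhao1995, Thm 3.10] -/
theorem norm_pfkL2_le_one (v : ℝ → ℝ≥0∞) (L t : ℝ) : ‖(pfkL2 v L t :
    Lp ℝ 2 (volume.restrict (cellN N L)) →L[ℝ] Lp ℝ 2 (volume.restrict (cellN N L)))‖ ≤ 1 := by
  unfold pfkL2
  split_ifs with h
  · exact LinearMap.mkContinuous_norm_le _ zero_le_one _
  · simp

/-- **The evaluation functional `g ↦ (e^{-tH} g)(X)` on `L²(cell)`** is bounded (`L²(cell) → L^∞`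
estimate, `t > 0`): `pfkEval v L t X g = pfkReal v L t (g ∘ cellProj L) X`. Its Riesz vector is the
torus kernel `u_t(X, ·)` (Chung–Zhao (1995), Thm 3.10 (28)). **Junk value** `0` unless `v` is
measurable, `t > 0` and `L > 0`. [cite: ChungZhao1995, Thm 3.10] -/
def pfkEval (v : ℝ → ℝ≥0∞) (L t : ℝ) (X : Config N) :
    Lp ℝ 2 (volume.restrict (cellN N L)) →L[ℝ] ℝ :=
  open Classical in
  if h : Measurable v ∧ 0 < t ∧ 0 < L then
    LinearMap.mkContinuous
      { toFun := fun g => pfkReal v L t (⇑g ∘ cellProj L) X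
        map_add' := fun g g' => by
          have := congrFun (pfkReal_coeFn_add h.1 h.2.2 h.2.1 g g') X
          simpa using this
        map_smul' := fun c g => by
          have := congrFun (pfkReal_coeFn_smul (v := v) h.2.2 h.2.1 c g) X
          simpa using this }
      (pHeatConst N L t.toNNReal * volume (cellN N L) ^ (1 / 2 : ℝ)).toReal
      (fun g => by
        simp only [LinearMap.coe_mk, AddHom.coe_mk, Lp.norm_def, eLpNorm_two_eq_cellN]
        rw [← ENNReal.toReal_mul, Real.norm_eq_abs, ← ENNReal.toReal_ofReal (abs_nonneg _),
          ← Real.enorm_eq_ofReal_abs, ← setLIntegral_cellN_enorm_comp_cellProj_sq h.2.2]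
        refine ENNReal.toReal_mono (ENNReal.mul_ne_top ?_ ?_)
          (enorm_pfkReal_le_L2cell v h.2.2 h.2.1 ((measurable_coeFn_Lp_cellN g).comp (measurable_cellProj L))
            (comp_cellProj_periodic h.2.2.ne' _) X)
        · exact ENNReal.mul_ne_top (pHeatConst_ne_top N h.2.2 _)
            (ENNReal.rpow_ne_top_of_nonneg (by norm_num) (volume_cellN_ne_top N L))
        · exact ENNReal.rpow_ne_top_of_nonneg (by norm_num)
            (setLIntegral_cellN_enorm_comp_cellProj_sq_ne_top h.2.2 g))
  else 0

/-- **`pfkEval` is evaluation of `pfkReal` on the periodic extension** (measurable `v`, `t > 0`,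
`L > 0`). [folklore] -/
@[simp] theorem pfkEval_apply {v : ℝ → ℝ≥0∞} (hv : Measurable v) {L : ℝ} (hL : 0 < L) {t : ℝ}
    (ht : 0 < t) (X : Config N) (g : Lp ℝ 2 (volume.restrict (cellN N L))) :
    pfkEval v L t X g = pfkReal v L t (⇑g ∘ cellProj L) X := by
  have h : Measurable v ∧ 0 < t ∧ 0 < L := ⟨hv, ht, hL⟩
  simp only [pfkEval, dif_pos h, LinearMap.mkContinuous_apply, LinearMap.coe_mk, AddHom.coe_mk]

/-- The evaluation functionals and the operator: `pfkEval v L t X g = (pfkL2 v L t g)(X)` for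
a.e. `X` in the cell. [folklore] -/
theorem pfkL2_coeFn_eq_pfkEval {v : ℝ → ℝ≥0∞} (hv : Measurable v) {L : ℝ} (hL : 0 < L) {t : ℝ}
    (ht : 0 < t) (g : Lp ℝ 2 (volume.restrict (cellN N L))) :
    (pfkL2 v L t g : Config N → ℝ) =ᵐ[volume.restrict (cellN N L)] fun X => pfkEval v L t X g := by
  filter_upwards [pfkL2_coeFn hv hL ht g] with X hX
  rw [hX, pfkEval_apply hv hL ht]

/-- **The periodic extension of the image class is the image function**, a.e. on `(ℝ³)^N`:
`(pfkL2 v L t g) ∘ cellProj L = pfkReal v L t (g ∘ cellProj L)` a.e. (the right-hand side is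
periodic). This is what makes the operator iterable (`semigroup law`). [folklore] -/
theorem pfkL2_coeFn_comp_cellProj {v : ℝ → ℝ≥0∞} (hv : Measurable v) {L : ℝ} (hL : 0 < L)
    {t : ℝ} (ht : 0 < t) (g : Lp ℝ 2 (volume.restrict (cellN N L))) :
    (pfkL2 v L t g : Config N → ℝ) ∘ cellProj L =ᵐ[(volume : Measure (Config N))]
      pfkReal v L t (⇑g ∘ cellProj L) := by
  have h1 := ae_comp_cellProj hL (pfkL2_coeFn hv hL ht g)
  rwa [comp_cellProj_eq_self (g := pfkReal v L t (⇑g ∘ cellProj L))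
    (pfkReal_add_single_of_periodic v L t (comp_cellProj_periodic hL.ne' _))] at h1

end Literature.MathematicalPhysics.QuantumManyBody.BoseGas

end
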